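/-
Copyright: cell pub-balaban-gaps (YM BLITZ Y1, track G1), seat g1-p2 GEN 11 (unit `pub-balaban-gaps-g1-p2`).  Row (D4) NODE O, MODEL level:
the BASE LETTER `h0` of `D4WalkBlockFormCoercive` for 59b–66's FLAT one-scale operator on the fine torus `Site P 0 × F` —
`A₀ = m²·1 + flatLap + a_K·P_K ⊗ 1` (63's `(msq : ℂ)•1 + flatLap + α•Pf`) — supplied hypothesis-free and k-UNIFORMLY from the tree's
`B4Claim18ZeroTorusEta.form_lower18_unif` (`min{8, a(1 − L⁻²)}·‖v‖² ≤ ⟨v, (−Δ^η + a_KQ*_KQ_K)v⟩`, g1-plan-1 GEN 38 (τ)): complexification and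
fibring of the real form bound; the conjugation defects of `flatLap` (cosh budget `2dη⁻²(cosh(κℓ) − 1)`, k-free at `ℓ = η`) and of the block
averaging `P_K ⊗ 1` (`cosh(κℓ_B) − 1` for a weight oscillating by at most `ℓ_B` on a K-block); hence conjugated coercivity of `A₀`, and the
remainder bound `Re conjForm (A₀ − flatLap) ≥ −a_Ke^{|κ|ℓ_B}` consumed by `D4WalkBlockFormGradientTorus.gradDom_covDop`.
HONEST FRAMING: model-level linear algebra ([folklore]) around ONE tree fact used BY NAME (`form_lower18_unif`); the weight is data; Bałaban's
`Δ^{(k)}(𝐔)` NOT constructed; (D4) instance 0∕1; NOT BetaPertH, NOT continuum, NOT Clay.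
-/
import Summits.QuantumFields.BalabanUV.Gaps.D4WalkBlockCovariantPropagator
import Summits.QuantumFields.BalabanUV.Gaps.D4WalkBlockLocalInverse
import Summits.QuantumFields.BalabanUV.T4Continuum.Support.CTWeightedCoercivity
import Literature.MathematicalPhysics.QuantumFieldTheory.Balaban1983to89.B4Claim18ZeroTorusEta

/-!
# `Gaps.D4WalkBlockFormBaseTorus` — the base letter: plain and conjugated coercivity of `m²·1 + flatLap + a_K(P_K ⊗ 1)` on the fine torus from
# `form_lower18_unif`, with k-free conjugation defects (cell pub-balaban-gaps, seat g1-p2 gen 11)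

HONEST DEPENDENCY (cell pub-balaban, verbatim): continuum YM on T⁴ ⇐ BetaPertH ∧ nine spine estimates (0/9 proved); BetaPertH ⇐ (D1) ∧ (D4) ∧ CAP+tail.

[B9] Thms 3.1–3.3 p. 397–399: the flat operator `Δ′ = −Δ^η + m² + a_kQ*_kQ_k` is bounded below uniformly in the scale ([B4] (1.8) p. 573: «γ₀ is
independent of the lattice spacing η»); the tree has this as `B4Claim18ZeroTorusEta.form_lower18_unif` for REAL scalar fields.  THIS FILE
([folklore] throughout):
* §1 complexification ∕ fibring: `blockDiagonal_const_mulVec`, `form_blockDiagonal_const` (`⟨z, (M ⊗ 1_F)z⟩ = Σ_a ⟨z_a, Mz_a⟩`),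
  `re_form_map_ofReal` (`Re ū·N̂u = x·Nx + y·Ny`), `nsq_eq_sum_fibre`, **`reCoercive_blockDiagonal_of_real`** (a real form bound `c‖v‖² ≤ ⟨v, Nv⟩` gives `c‖z‖² ≤ Re⟨z, (N ⊗ 1_F)z⟩`);
* §2 **`flatOp_eq_blockDiagonal`** (`m²·1 + flatLap + α•Pf = (m²·1 + (−Δ^η + a_KQ*_KQ_K)) ⊗ 1_F`, 63's `blockDiagonal_H` BY NAME),
  **`reCoercive_flatOp`** (`min{8, a(1 − L⁻²)}·‖z‖² ≤ Re⟨z, (m²·1 + flatLap + α•Pf)z⟩`, `m² ≥ 0`, `K ≥ 1`, `a > 0`);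
* §3 `Pf = P_K ⊗ 1`: kernel `Pf_apply` (`[a = b]·[B(x) = B(x′)]·L^{−dK}`), `sum_norm_Pf_row` (`= 1`), `Pf_isHermitian`, `ctRowDefect_Pf_le`
  (`≤ cosh(|κ|ℓ_B) − 1`), `cRow_Pf_le` ∕ `cCol_Pf_le` (`≤ e^{|κ|ℓ_B}`); §4 `flatLap_isHermitian`, `ctRowDefect_flatLap_le` (`≤ 2d·η⁻²(cosh(|κ|ℓ) − 1)`);
* §5 **`wCoercive_flatOp`** — conjugated coercivity `min{8, a(1 − L⁻²)} − 2dη⁻²(cosh(|κ|ℓ) − 1) − α(cosh(|κ|ℓ_B) − 1)` (the `h0` of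
  `D4WalkBlockFormCoercive`), **`re_conjForm_flatOp_sub_flatLap_ge`** (`Re conjForm (A₀ − flatLap) z ≥ −αe^{|κ|ℓ_B}‖z‖²`: the `hrest` of
  `D4WalkBlockFormGradientTorus.gradDom_covDop`); at `ℓ = η`: `η⁻²(cosh(κη) − 1) ≤ ½κ²cosh(κη)` — the k-free reading.
WHAT IT IS NOT.  The multiplier letters of `covShift` from 66's windows and the gauge presentation are NOT here; (D4) instance 0∕1; words of row
(D4) UNCHANGED (`ExistsUniformAcrossSmall 𝓣_Bałaban α Rσ₀ θ₀` + `TermDomination`, OBJECT level).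

References (method only): T. Bałaban, Comm. Math. Phys. **89** (1983) 571–597 [B4], (1.8) p. 573; Comm. Math. Phys. **99** (1985) 389–434 [B9],
(3.23) p. 394, Thms 3.1–3.3 pp. 397–399, (3.42) p. 399, Cor. 3.6 p. 408.
-/

noncomputable section

namespace Summit.QuantumFields.BalabanUV.Gaps.D4WalkBlockFormBaseTorus

open Finset Complex Matrix
open scoped BigOperators Matrix ComplexConjugate
open Literature.MathematicalPhysics.QuantumFieldTheory.Balaban1983to89
open Literature.MathematicalPhysics.QuantumFieldTheory.Balaban1983to89.B5Prop11Lower (nsq nsq_nonneg)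
open Literature.MathematicalPhysics.QuantumFieldTheory.Balaban1983to89.B1RG242Torus (hOp Qk Qks tower)
open Literature.MathematicalPhysics.QuantumFieldTheory.Balaban1983to89.Beta.DeltaACombesThomas (ctWeight ctRowDefect ctWeight_self ctWeight_nonneg
  ctRowDefect_add_le ctRowDefect_sub_le ctRowDefect_smul)
open Summit.QuantumFields.BalabanUV.Beta.AccretiveCombesThomas (conjForm conjForm_add)
open Summit.QuantumFields.BalabanUV.T4Continuum.CTWeightedCoercivity (conjMat conjMat_apply conjMat_smul conjMat_one conjForm_eq ConjDefect
  conjDefect_of_rowDefect WCoercive wCoercive_of_coercive)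
open Summit.QuantumFields.BalabanUV.T4Continuum.CoerciveInverseTower (Coercive)
open Summit.QuantumFields.BalabanUV.Gaps.D4WalkBlockCovariantGeometry (SBf shift_unshift)
open Summit.QuantumFields.BalabanUV.Gaps.D4WalkBlockCovariantShift (Sf flatLap)
open Summit.QuantumFields.BalabanUV.Gaps.D4WalkBlockCovariantPropagator (Pf unshift_shift blockDiagonal_H)
open Summit.QuantumFields.BalabanUV.Gaps.D4WalkBlockLocalInverse (cRow cCol re_conjForm_ge_neg_schur)

variable {P : Params} {F : Type} [Fintype F] [DecidableEq F]

/-! ## §1. Complexification and fibring of a real form bound -/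

/-- a fibre-constant block-diagonal operator acts fibrewise: `((M ⊗ 1_F)z)(x,a) = (M z(·,a))(x)`. [folklore] -/
theorem blockDiagonal_const_mulVec (M : Matrix (Site P 0) (Site P 0) ℂ) (z : Site P 0 × F → ℂ) (p : Site P 0 × F) :
    (Matrix.blockDiagonal (fun _ : F => M) *ᵥ z) p = (M *ᵥ fun x' => z (x', p.2)) p.1 := by
  obtain ⟨x, a⟩ := p
  rw [Matrix.mulVec, Matrix.mulVec, dotProduct, dotProduct, Fintype.sum_prod_type]
  refine Finset.sum_congr rfl fun x' _ => ?_
  simp_rw [Matrix.blockDiagonal_apply, ite_mul, zero_mul]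
  rw [Finset.sum_ite_eq, if_pos (Finset.mem_univ _)]

/-- the form of a fibre-constant block-diagonal operator is the sum of the fibre forms. [folklore] -/
theorem form_blockDiagonal_const (M : Matrix (Site P 0) (Site P 0) ℂ) (z : Site P 0 × F → ℂ) :
    star z ⬝ᵥ (Matrix.blockDiagonal (fun _ : F => M) *ᵥ z) = ∑ a : F, star (fun x => z (x, a)) ⬝ᵥ (M *ᵥ fun x => z (x, a)) := by
  rw [dotProduct, Fintype.sum_prod_type, Finset.sum_comm]
  refine Finset.sum_congr rfl fun a _ => Finset.sum_congr rfl fun x _ => ?_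
  rw [blockDiagonal_const_mulVec]
  rfl

omit [DecidableEq F] in
/-- `Re ū·N̂u = x·Nx + y·Ny` (`x = Re u`, `y = Im u`; any real square `N`; the β cell's GAN24 pattern for the coercion `ℝ → ℂ`). [folklore] -/
theorem re_form_map_ofReal (N : Matrix (Site P 0) (Site P 0) ℝ) (u : Site P 0 → ℂ) :
    (star u ⬝ᵥ (N.map ((↑) : ℝ → ℂ) *ᵥ u)).re
      = (fun i => (u i).re) ⬝ᵥ (N *ᵥ fun i => (u i).re) + (fun i => (u i).im) ⬝ᵥ (N *ᵥ fun i => (u i).im) := by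
  simp only [dotProduct, Matrix.mulVec, Matrix.map_apply, Pi.star_apply, Complex.star_def, Complex.re_sum, Complex.mul_re,
    Complex.conj_re, Complex.conj_im, Complex.im_sum, Complex.mul_im, Complex.ofReal_re, Complex.ofReal_im, zero_mul, sub_zero,
    add_zero, ← Finset.sum_add_distrib]
  refine Finset.sum_congr rfl fun i _ => ?_
  simp only [neg_mul, Finset.sum_neg_distrib, sub_neg_eq_add, Finset.mul_sum]

omit [DecidableEq F] in
/-- `‖z‖² = Σ_a (x_a·x_a + y_a·y_a)`. [folklore] -/
theorem nsq_eq_sum_fibre (z : Site P 0 × F → ℂ) :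
    nsq z = ∑ a : F, ((fun x => (z (x, a)).re) ⬝ᵥ (fun x => (z (x, a)).re) + (fun x => (z (x, a)).im) ⬝ᵥ (fun x => (z (x, a)).im)) := by
  rw [nsq, Fintype.sum_prod_type, Finset.sum_comm]
  refine Finset.sum_congr rfl fun a _ => ?_
  rw [dotProduct, dotProduct, ← Finset.sum_add_distrib]
  exact Finset.sum_congr rfl fun x _ => by rw [Complex.sq_norm, Complex.normSq_apply]

/-- **a real form bound complexifies and fibres**: `c‖v‖² ≤ ⟨v, Nv⟩` for all real `v` ⟹ `c‖z‖² ≤ Re⟨z, (N ⊗ 1_F)z⟩` for all complex fibred `z`.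
[folklore] -/
theorem reCoercive_blockDiagonal_of_real (N : Matrix (Site P 0) (Site P 0) ℝ) {c : ℝ} (hN : ∀ v : Site P 0 → ℝ, c * (v ⬝ᵥ v) ≤ v ⬝ᵥ (N *ᵥ v))
    (z : Site P 0 × F → ℂ) : c * nsq z ≤ (star z ⬝ᵥ (Matrix.blockDiagonal (fun _ : F => N.map ((↑) : ℝ → ℂ)) *ᵥ z)).re := by
  rw [form_blockDiagonal_const, Complex.re_sum, nsq_eq_sum_fibre, Finset.mul_sum]
  refine Finset.sum_le_sum fun a _ => ?_
  rw [re_form_map_ofReal, mul_add]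
  exact add_le_add (hN _) (hN _)

/-! ## §2. The flat one-scale operator as a fibred real operator; plain coercivity from `form_lower18_unif` -/

/-- **`m²·1 + flatLap + α•Pf = (m²·1 + (−Δ^η + a_KQ*_KQ_K)) ⊗ 1_F`** (63's `blockDiagonal_H` plus the averaging term). -/
theorem flatOp_eq_blockDiagonal (a msq : ℝ) :
    (msq : ℂ) • (1 : Matrix (Site P 0 × F) (Site P 0 × F) ℂ) + flatLap P F + (B1RG242Torus.α P a P.K : ℂ) • Pf P F
      = Matrix.blockDiagonal fun _ : F =>
          (msq • (1 : Matrix (Site P 0) (Site P 0) ℝ) + (hOp P 0 P.eps 0 + B1RG242Torus.α P a P.K • (Qks P P.K * Qk P P.K))).map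
            ((↑) : ℝ → ℂ) := by
  have hH : hOp P 0 P.eps msq = msq • (1 : Matrix (Site P 0) (Site P 0) ℝ) + hOp P 0 P.eps 0 := by
    simp only [hOp, zero_smul, zero_add]
  have hadd : ∀ M N : Matrix (Site P 0) (Site P 0) ℝ, (M + N).map ((↑) : ℝ → ℂ) = M.map ((↑) : ℝ → ℂ) + N.map ((↑) : ℝ → ℂ) :=
    fun M N => by ext x y; simp
  have hsmul : ∀ (r : ℝ) (M : Matrix (Site P 0) (Site P 0) ℝ), (r • M).map ((↑) : ℝ → ℂ) = (r : ℂ) • M.map ((↑) : ℝ → ℂ) :=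
    fun r M => by ext x y; simp
  have hmap : (msq • (1 : Matrix (Site P 0) (Site P 0) ℝ) + (hOp P 0 P.eps 0 + B1RG242Torus.α P a P.K • (Qks P P.K * Qk P P.K))).map
      ((↑) : ℝ → ℂ) = (B1RG242Torus.H P msq).map ((↑) : ℝ → ℂ) + (B1RG242Torus.α P a P.K : ℂ) • (Qks P P.K * Qk P P.K).map ((↑) : ℝ → ℂ) := by
    rw [← add_assoc, ← hH, show B1RG242Torus.H P msq = hOp P 0 P.eps msq from rfl, hadd, hsmul]
  simp_rw [hmap]
  rw [show (fun _ : F => (B1RG242Torus.H P msq).map ((↑) : ℝ → ℂ) + (B1RG242Torus.α P a P.K : ℂ) • (Qks P P.K * Qk P P.K).map ((↑) : ℝ → ℂ))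
      = (fun _ : F => (B1RG242Torus.H P msq).map ((↑) : ℝ → ℂ)) + (B1RG242Torus.α P a P.K : ℂ) • (fun _ : F => (Qks P P.K * Qk P P.K).map
        ((↑) : ℝ → ℂ)) from rfl, Matrix.blockDiagonal_add, Matrix.blockDiagonal_smul, blockDiagonal_H]
  rfl

/-- **PLAIN COERCIVITY OF THE FLAT ONE-SCALE OPERATOR**, k-UNIFORM: `min{8, a(1 − L⁻²)}·‖z‖² ≤ Re⟨z, (m²·1 + flatLap + α•Pf)z⟩` for `m² ≥ 0`,
`K ≥ 1`, `a > 0` — `form_lower18_unif` complexified and fibred, the mass dropped. [cite: Balaban1983RegularityDecay, (1.8) p.573; Balaban1985BackgroundPropagators, Thms 3.1–3.3 p.399] -/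
theorem reCoercive_flatOp {a : ℝ} (ha : 0 < a) {msq : ℝ} (hmsq : 0 ≤ msq) (hK : 1 ≤ P.K) (z : Site P 0 × F → ℂ) :
    min 8 (a * (1 - (((P.L : ℝ)) ^ 2)⁻¹)) * nsq z
      ≤ (star z ⬝ᵥ (((msq : ℂ) • (1 : Matrix (Site P 0 × F) (Site P 0 × F) ℂ) + flatLap P F + (B1RG242Torus.α P a P.K : ℂ) • Pf P F) *ᵥ z)).re := by
  rw [flatOp_eq_blockDiagonal]
  refine reCoercive_blockDiagonal_of_real _ (fun v => ?_) z
  have h := B4Claim18ZeroTorusEta.form_lower18_unif P ha msq hK v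
  have hm : 0 ≤ msq * (v ⬝ᵥ v) := mul_nonneg hmsq (Finset.sum_nonneg fun i _ => mul_self_nonneg (v i))
  rw [Matrix.add_mulVec, dotProduct_add, Matrix.smul_mulVec, Matrix.one_mulVec, dotProduct_smul, smul_eq_mul]
  exact le_add_of_nonneg_of_le hm h

/-! ## §3. The block averaging `Pf = P_K ⊗ 1_F`: kernel, unit row sums, Hermitian, conjugation letters -/

/-- the kernel of `Q*_KQ_K`: `[B(x′) = B(x)]·L^{−d·lvl K}`. -/
theorem QksQk_apply (x x' : Site P 0) :
    (Qks P P.K * Qk P P.K) x x' = if Site.proj P.K (B1RG242Torus.lvl P P.K) x' = Site.proj P.K (B1RG242Torus.lvl P P.K) x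
      then (((P.L : ℝ) ^ P.d)⁻¹) ^ B1RG242Torus.lvl P P.K else 0 := by
  simp only [Qks, Qk, B1RG242Torus.extMat, B1RG242Torus.avgMat, Matrix.mul_apply, ite_mul, one_mul, zero_mul]
  rw [Finset.sum_ite_eq]
  simp

omit [Fintype F] in
/-- the kernel of `Pf`: `Pf (x,a) (x′,b) = [a = b]·[B(x′) = B(x)]·L^{−d·lvl K}`. -/
theorem Pf_apply (p q : Site P 0 × F) :
    Pf P F p q = if p.2 = q.2 then (if Site.proj P.K (B1RG242Torus.lvl P P.K) q.1 = Site.proj P.K (B1RG242Torus.lvl P P.K) p.1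
      then (((((P.L : ℝ) ^ P.d)⁻¹) ^ B1RG242Torus.lvl P P.K : ℝ) : ℂ) else 0) else 0 := by
  obtain ⟨x, a⟩ := p
  obtain ⟨x', b⟩ := q
  rw [Pf, Matrix.blockDiagonal_apply]
  simp only [Matrix.map_apply, QksQk_apply]
  split_ifs <;> simp

omit [Fintype F] in
/-- the norm of the kernel of `Pf`. -/
theorem norm_Pf_apply (p q : Site P 0 × F) :
    ‖Pf P F p q‖ = if p.2 = q.2 ∧ Site.proj P.K (B1RG242Torus.lvl P P.K) q.1 = Site.proj P.K (B1RG242Torus.lvl P P.K) p.1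
      then (((P.L : ℝ) ^ P.d)⁻¹) ^ B1RG242Torus.lvl P P.K else 0 := by
  rw [Pf_apply]
  by_cases h1 : p.2 = q.2
  · by_cases h2 : Site.proj P.K (B1RG242Torus.lvl P P.K) q.1 = Site.proj P.K (B1RG242Torus.lvl P P.K) p.1
    · rw [if_pos h1, if_pos h2, if_pos ⟨h1, h2⟩, Complex.norm_real, Real.norm_eq_abs, abs_of_nonneg (by positivity)]
    · rw [if_pos h1, if_neg h2, if_neg (fun h => h2 h.2), norm_zero]
  · rw [if_neg h1, if_neg (fun h => h1 h.1), norm_zero]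

/-- **unit row sums**: `Σ_q ‖Pf p q‖ = 1` (`L^{d·lvl K}` sites per block, weight `L^{−d·lvl K}`). -/
theorem sum_norm_Pf_row (p : Site P 0 × F) : ∑ q, ‖Pf P F p q‖ = 1 := by
  simp_rw [norm_Pf_apply]
  rw [Fintype.sum_prod_type]
  have hinner : ∀ x' : Site P 0, ∑ b : F, (if p.2 = b ∧ Site.proj P.K (B1RG242Torus.lvl P P.K) x' = Site.proj P.K (B1RG242Torus.lvl P P.K) p.1
      then (((P.L : ℝ) ^ P.d)⁻¹) ^ B1RG242Torus.lvl P P.K else 0)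
      = if Site.proj P.K (B1RG242Torus.lvl P P.K) x' = Site.proj P.K (B1RG242Torus.lvl P P.K) p.1
          then (((P.L : ℝ) ^ P.d)⁻¹) ^ B1RG242Torus.lvl P P.K else 0 := by
    intro x'
    by_cases h : Site.proj P.K (B1RG242Torus.lvl P P.K) x' = Site.proj P.K (B1RG242Torus.lvl P P.K) p.1
    · simp only [h, and_true, Finset.sum_ite_eq, Finset.mem_univ, if_true]
    · simp [h]
  simp_rw [hinner]
  rw [← Finset.sum_filter, Finset.sum_const, Site.card_fibre (B1RG242Torus.sitesPerDir_zero_eq P P.K), nsmul_eq_mul, mul_comm]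
  push_cast
  exact B1RG242Torus.winv_pow_mul_eq_one P _

omit [Fintype F] in
/-- `Pf` is Hermitian (real symmetric kernel). -/
theorem Pf_isHermitian : (Pf P F).IsHermitian := by
  refine Matrix.IsHermitian.ext fun p q => ?_
  rw [Pf_apply, Pf_apply]
  by_cases h1 : q.2 = p.2
  · by_cases h2 : Site.proj P.K (B1RG242Torus.lvl P P.K) p.1 = Site.proj P.K (B1RG242Torus.lvl P P.K) q.1
    · rw [if_pos h1, if_pos h2, if_pos h1.symm, if_pos h2.symm, Complex.star_def, Complex.conj_ofReal]
    · rw [if_pos h1, if_neg h2, if_pos h1.symm, if_neg (fun h => h2 h.symm), star_zero]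
  · rw [if_neg h1, if_neg (fun h => h1 h.symm), star_zero]

/-- a weighted row sum of `Pf` against a weight bounded by `C` on the block of the row is `≤ C`. -/
theorem sum_norm_Pf_mul_le (p : Site P 0 × F) (w : Site P 0 × F → ℝ) {C : ℝ}
    (hw : ∀ q, p.2 = q.2 → Site.proj P.K (B1RG242Torus.lvl P P.K) q.1 = Site.proj P.K (B1RG242Torus.lvl P P.K) p.1 → w q ≤ C) :
    ∑ q, ‖Pf P F p q‖ * w q ≤ C := by
  calc ∑ q, ‖Pf P F p q‖ * w q ≤ ∑ q, ‖Pf P F p q‖ * C := Finset.sum_le_sum fun q _ => by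
          by_cases h : p.2 = q.2 ∧ Site.proj P.K (B1RG242Torus.lvl P P.K) q.1 = Site.proj P.K (B1RG242Torus.lvl P P.K) p.1
          · exact mul_le_mul_of_nonneg_left (hw q h.1 h.2) (norm_nonneg _)
          · rw [norm_Pf_apply, if_neg h, zero_mul, zero_mul]
    _ = C := by rw [← Finset.sum_mul, sum_norm_Pf_row, one_mul]

variable (ρ : Site P 0 × F → ℝ) {ℓB : ℝ}
  (hρB : ∀ (x x' : Site P 0) (a : F), Site.proj P.K (B1RG242Torus.lvl P P.K) x' = Site.proj P.K (B1RG242Torus.lvl P P.K) x →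
    |ρ (x, a) - ρ (x', a)| ≤ ℓB)
include hρB

omit [Fintype F] [DecidableEq F] in
/-- on the support of row `p` of `Pf` the weight differs from `ρ p` by at most `ℓ_B`, so `|κ(ρ p − ρ q)| ≤ |κ|ℓ_B`. -/
theorem abs_mul_sub_le_of_block (κ : ℝ) {p q : Site P 0 × F} (h1 : p.2 = q.2)
    (h2 : Site.proj P.K (B1RG242Torus.lvl P P.K) q.1 = Site.proj P.K (B1RG242Torus.lvl P P.K) p.1) : |κ * (ρ p - ρ q)| ≤ |κ| * ℓB := by
  have h := hρB p.1 q.1 p.2 h2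
  rw [show ((q.1, p.2) : Site P 0 × F) = q from Prod.ext rfl h1] at h
  rw [abs_mul]
  exact mul_le_mul_of_nonneg_left h (abs_nonneg _)

/-- **the conjugation defect of the block averaging**: `ctRowDefect Pf κ ρ ≤ cosh(|κ|ℓ_B) − 1` for a weight oscillating by at most `ℓ_B`
within a fibre over a K-block. [cite: Balaban1985BackgroundPropagators, (3.42) p.399] -/
theorem ctRowDefect_Pf_le (κ : ℝ) (p : Site P 0 × F) : ctRowDefect (Pf P F) κ ρ p ≤ Real.cosh (|κ| * ℓB) - 1 := by
  refine sum_norm_Pf_mul_le p _ fun q h1 h2 => ?_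
  have hb : |κ * (ρ p - ρ q)| ≤ |(|κ| * ℓB)| := (abs_mul_sub_le_of_block ρ hρB κ h1 h2).trans (le_abs_self _)
  unfold ctWeight
  linarith [Real.cosh_le_cosh.mpr hb]

/-- the conjugated ROW sums of `Pf`: `cRow Pf κ ρ ≤ e^{|κ|ℓ_B}`. -/
theorem cRow_Pf_le (κ : ℝ) (p : Site P 0 × F) : cRow (Pf P F) κ ρ p ≤ Real.exp (|κ| * ℓB) :=
  sum_norm_Pf_mul_le p _ fun _ h1 h2 => Real.exp_le_exp.mpr ((le_abs_self _).trans (abs_mul_sub_le_of_block ρ hρB κ h1 h2))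

/-- the conjugated COLUMN sums of `Pf`: `cCol Pf κ ρ ≤ e^{|κ|ℓ_B}`. -/
theorem cCol_Pf_le (κ : ℝ) (q : Site P 0 × F) : cCol (Pf P F) κ ρ q ≤ Real.exp (|κ| * ℓB) := by
  have hsw : ∀ p, ‖Pf P F p q‖ = ‖Pf P F q p‖ := fun p => by
    conv_lhs => rw [← (Pf_isHermitian (P := P) (F := F)).apply p q]
    exact norm_star _
  unfold cCol
  simp_rw [hsw]
  refine sum_norm_Pf_mul_le q _ fun p h1 h2 => Real.exp_le_exp.mpr ((le_abs_self _).trans ?_)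
  rw [← abs_neg, ← mul_neg, neg_sub]
  exact abs_mul_sub_le_of_block ρ hρB κ h1 h2

omit hρB

/-! ## §4. The flat Laplacian: Hermitian, cosh conjugation defect -/

omit [Fintype F] in
/-- `(S_μ ⊗ 1)ᴴ = S⁻_μ ⊗ 1` (63's `Sf_transpose`, entries real). -/
theorem Sf_conjTranspose (μ : Fin P.d) : (Sf P F μ)ᴴ = SBf P F μ := by
  rw [Matrix.conjTranspose, D4WalkBlockCovariantPropagator.Sf_transpose]
  ext p q
  simp only [Matrix.map_apply, SBf, Matrix.of_apply]
  split_ifs <;> simp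

omit [Fintype F] in
/-- `(S⁻_μ ⊗ 1)ᴴ = S_μ ⊗ 1`. -/
theorem SBf_conjTranspose (μ : Fin P.d) : (SBf P F μ)ᴴ = Sf P F μ := by
  rw [← Sf_conjTranspose, Matrix.conjTranspose_conjTranspose]

omit [Fintype F] in
/-- `flatLap` is Hermitian. -/
theorem flatLap_isHermitian : (flatLap P F).IsHermitian := by
  unfold Matrix.IsHermitian flatLap
  rw [Matrix.conjTranspose_smul, Matrix.conjTranspose_sum]
  simp_rw [Matrix.conjTranspose_sub, Matrix.conjTranspose_smul, Matrix.conjTranspose_one, Sf_conjTranspose, SBf_conjTranspose]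
  have hε : star (((P.eps⁻¹ : ℂ)) ^ 2) = (P.eps⁻¹ : ℂ) ^ 2 := by
    rw [star_pow, ← Complex.ofReal_inv, Complex.star_def, Complex.conj_ofReal]
  rw [hε, star_ofNat]
  congr 1
  exact Finset.sum_congr rfl fun μ _ => by abel

/-- the cosh defect of a ONE-ENTRY-PER-ROW kernel `[q = σ p]` is `cosh(κ(ρ p − ρ(σ p))) − 1 ≤ cosh(|κ|ℓ) − 1` when `|ρ p − ρ(σ p)| ≤ ℓ`. -/
theorem ctRowDefect_perm_le (σ : Site P 0 × F → Site P 0 × F) {ℓ : ℝ} (κ : ℝ) (p : Site P 0 × F) (hσ : |ρ p - ρ (σ p)| ≤ ℓ) :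
    ctRowDefect (Matrix.of fun p q : Site P 0 × F => if q = σ p then (1 : ℂ) else 0) κ ρ p ≤ Real.cosh (|κ| * ℓ) - 1 := by
  unfold ctRowDefect
  rw [Finset.sum_eq_single (σ p) (fun q _ hq => by rw [Matrix.of_apply, if_neg hq, norm_zero, zero_mul])
    (fun h => absurd (Finset.mem_univ _) h), Matrix.of_apply, if_pos rfl, norm_one, one_mul]
  unfold ctWeight
  have hb : |κ * (ρ p - ρ (σ p))| ≤ |(|κ| * ℓ)| := by
    rw [abs_mul, abs_of_nonneg (mul_nonneg (abs_nonneg κ) ((abs_nonneg _).trans hσ))]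
    exact mul_le_mul_of_nonneg_left hσ (abs_nonneg _)
  linarith [Real.cosh_le_cosh.mpr hb]

/-- the cosh defects of `S_μ ⊗ 1` and `S⁻_μ ⊗ 1`: `≤ cosh(|κ|ℓ) − 1` for a weight moving by at most `ℓ` across a fine bond. -/
theorem ctRowDefect_Sf_SBf_le {ℓ : ℝ} (hρ : ∀ (p : Site P 0 × F) (μ : Fin P.d), |ρ p - ρ (Site.shift p.1 μ, p.2)| ≤ ℓ) (κ : ℝ) (μ : Fin P.d)
    (p : Site P 0 × F) :
    ctRowDefect (Sf P F μ) κ ρ p ≤ Real.cosh (|κ| * ℓ) - 1 ∧ ctRowDefect (SBf P F μ) κ ρ p ≤ Real.cosh (|κ| * ℓ) - 1 := by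
  refine ⟨ctRowDefect_perm_le ρ (fun p => (Site.shift p.1 μ, p.2)) κ p (hρ p μ), ctRowDefect_perm_le ρ (fun p => (Site.unshift p.1 μ, p.2)) κ p ?_⟩
  have h := hρ (Site.unshift p.1 μ, p.2) μ
  rwa [shift_unshift, abs_sub_comm] at h

/-- the cosh defect of a multiple of the identity vanishes (the diagonal carries weight `cosh 0 − 1 = 0`). [folklore] -/
theorem ctRowDefect_smul_one {ι : Type*} [Fintype ι] [DecidableEq ι] (c : ℂ) (κ : ℝ) (τ : ι → ℝ) (e : ι) :
    ctRowDefect (c • (1 : Matrix ι ι ℂ)) κ τ e = 0 := by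
  refine Finset.sum_eq_zero fun q _ => ?_
  by_cases h : e = q
  · subst h; rw [ctWeight_self, mul_zero]
  · rw [Matrix.smul_apply, Matrix.one_apply_ne h, smul_zero, norm_zero, zero_mul]

/-- the cosh defect of a finite sum of kernels with a common bound. [folklore] -/
theorem ctRowDefect_sum_le {ι : Type*} [Fintype ι] {μs : Type*} (s : Finset μs) (T : μs → Matrix ι ι ℂ) (κ : ℝ) (τ : ι → ℝ) (e : ι)
    {C : ℝ} (hT : ∀ μ, ctRowDefect (T μ) κ τ e ≤ C) : ctRowDefect (∑ μ ∈ s, T μ) κ τ e ≤ s.card * C := by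
  induction s using Finset.cons_induction with
  | empty =>
      rw [Finset.sum_empty, Finset.card_empty, Nat.cast_zero, zero_mul]
      exact le_of_eq (Finset.sum_eq_zero fun q _ => by rw [Matrix.zero_apply, norm_zero, zero_mul])
  | cons a s ha ih =>
      rw [Finset.sum_cons, Finset.card_cons, Nat.cast_add, Nat.cast_one, add_mul, one_mul, add_comm ((s.card : ℝ) * _)]
      exact (ctRowDefect_add_le _ _ κ τ e).trans (add_le_add (hT a) ih)

/-- **the conjugation defect of the flat Laplacian**: `ctRowDefect flatLap κ ρ ≤ 2d·η⁻²(cosh(|κ|ℓ) − 1)` for a weight moving by at most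
`ℓ` across a fine bond (the diagonal does not contribute). [cite: Balaban1985BackgroundPropagators, (3.42) p.399, Cor. 3.6 p.408] -/
theorem ctRowDefect_flatLap_le {ℓ : ℝ} (hρ : ∀ (p : Site P 0 × F) (μ : Fin P.d), |ρ p - ρ (Site.shift p.1 μ, p.2)| ≤ ℓ) (κ : ℝ)
    (p : Site P 0 × F) : ctRowDefect (flatLap P F) κ ρ p ≤ 2 * P.d * (P.eps⁻¹ ^ 2 * (Real.cosh (|κ| * ℓ) - 1)) := by
  have hterm : ∀ μ : Fin P.d, ctRowDefect ((2 : ℂ) • (1 : Matrix (Site P 0 × F) (Site P 0 × F) ℂ) - Sf P F μ - SBf P F μ) κ ρ p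
      ≤ 2 * (Real.cosh (|κ| * ℓ) - 1) := by
    intro μ
    have a1 := ctRowDefect_sub_le ((2 : ℂ) • (1 : Matrix (Site P 0 × F) (Site P 0 × F) ℂ) - Sf P F μ) (SBf P F μ) κ ρ p
    have a2 := ctRowDefect_sub_le ((2 : ℂ) • (1 : Matrix (Site P 0 × F) (Site P 0 × F) ℂ)) (Sf P F μ) κ ρ p
    have a3 := ctRowDefect_smul_one (2 : ℂ) κ ρ p
    have a4 := ctRowDefect_Sf_SBf_le ρ hρ κ μ p
    linarith [a4.1, a4.2]
  have h := ctRowDefect_sum_le Finset.univ (fun μ => (2 : ℂ) • (1 : Matrix (Site P 0 × F) (Site P 0 × F) ℂ) - Sf P F μ - SBf P F μ) κ ρ p hterm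
  rw [Finset.card_univ, Fintype.card_fin] at h
  unfold flatLap
  rw [ctRowDefect_smul, norm_pow, ← Complex.ofReal_inv, Complex.norm_real, Real.norm_eq_abs, abs_of_pos (inv_pos.mpr P.eps_pos)]
  have hε : 0 ≤ P.eps⁻¹ ^ 2 := sq_nonneg _
  nlinarith

/-! ## §5. Assembly: conjugated coercivity of the flat one-scale operator; the remainder bound -/

/-- the conjugated form of a multiple of the identity is the multiple of `‖z‖²` (the diagonal is not conjugated). -/
theorem conjForm_smul_one (c : ℂ) (κ : ℝ) (z : Site P 0 × F → ℂ) :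
    conjForm (c • (1 : Matrix (Site P 0 × F) (Site P 0 × F) ℂ)) κ ρ z = c * ((nsq z : ℝ) : ℂ) := by
  rw [conjForm_eq, conjMat_smul, conjMat_one κ ρ, Matrix.smul_mulVec, Matrix.one_mulVec, dotProduct_smul, smul_eq_mul,
    B5Prop11Lower.star_dotProduct_self]

/-- **THE BASE LETTER `h0`, k-UNIFORM**: conjugated coercivity of `A₀ = m²·1 + flatLap + α•Pf` at rate `κ` along a weight moving by at most `ℓ`
across fine bonds and oscillating by at most `ℓ_B` on K-block fibres:
`(min{8, a(1 − L⁻²)} − 2dη⁻²(cosh(|κ|ℓ) − 1) − α(cosh(|κ|ℓ_B) − 1))·‖z‖² ≤ Re conjForm A₀ z` (`m² ≥ 0`, `K ≥ 1`, `a > 0`, `α = a_K·(L^Kη)⁻² ≥ 0`).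
At `ℓ = η`, `ℓ_B = dη·L^K = d` every constant is bounded uniformly in the scale. [cite: Balaban1983RegularityDecay, (1.8) p.573; Balaban1985BackgroundPropagators, Thms 3.1–3.3 p.399, (3.42) p.399, Cor. 3.6 p.408] -/
theorem wCoercive_flatOp {a : ℝ} (ha : 0 < a) {msq : ℝ} (hmsq : 0 ≤ msq) (hK : 1 ≤ P.K) (hα : 0 ≤ B1RG242Torus.α P a P.K) {ℓ : ℝ}
    (hρ : ∀ (p : Site P 0 × F) (μ : Fin P.d), |ρ p - ρ (Site.shift p.1 μ, p.2)| ≤ ℓ)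
    (hρB : ∀ (x x' : Site P 0) (b : F), Site.proj P.K (B1RG242Torus.lvl P P.K) x' = Site.proj P.K (B1RG242Torus.lvl P P.K) x →
      |ρ (x, b) - ρ (x', b)| ≤ ℓB) (κ : ℝ) :
    WCoercive ((msq : ℂ) • (1 : Matrix (Site P 0 × F) (Site P 0 × F) ℂ) + flatLap P F + (B1RG242Torus.α P a P.K : ℂ) • Pf P F) κ ρ
      (min 8 (a * (1 - (((P.L : ℝ)) ^ 2)⁻¹)) - (0 + 2 * P.d * (P.eps⁻¹ ^ 2 * (Real.cosh (|κ| * ℓ) - 1))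
        + B1RG242Torus.α P a P.K * (Real.cosh (|κ| * ℓB) - 1))) := by
  refine wCoercive_of_coercive (fun z => reCoercive_flatOp ha hmsq hK z) ?_
  refine ConjDefect.add (ConjDefect.add (fun z => ?_) (conjDefect_of_rowDefect flatLap_isHermitian (ctRowDefect_flatLap_le ρ hρ κ))) ?_
  · rw [conjForm_smul_one, Matrix.smul_mulVec, Matrix.one_mulVec, dotProduct_smul, smul_eq_mul, B5Prop11Lower.star_dotProduct_self,
      sub_self, abs_zero, zero_mul]
  · have hH : ((B1RG242Torus.α P a P.K : ℂ) • Pf P F).IsHermitian := by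
      unfold Matrix.IsHermitian
      rw [Matrix.conjTranspose_smul, Pf_isHermitian.eq, Complex.star_def, Complex.conj_ofReal]
    refine conjDefect_of_rowDefect hH fun p => ?_
    rw [ctRowDefect_smul, Complex.norm_real, Real.norm_eq_abs, abs_of_nonneg hα]
    exact mul_le_mul_of_nonneg_left (ctRowDefect_Pf_le ρ hρB κ p) hα

/-- **THE REMAINDER BOUND `hrest`** of `D4WalkBlockFormGradientTorus.gradDom_covDop`: `Re conjForm (A₀ − flatLap) z ≥ −αe^{|κ|ℓ_B}·‖z‖²` (the mass
is `≥ 0`; the averaging term by its conjugated Schur sums). -/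
theorem re_conjForm_flatOp_sub_flatLap_ge {a msq : ℝ} (hmsq : 0 ≤ msq) (hα : 0 ≤ B1RG242Torus.α P a P.K)
    (hρB : ∀ (x x' : Site P 0) (b : F), Site.proj P.K (B1RG242Torus.lvl P P.K) x' = Site.proj P.K (B1RG242Torus.lvl P P.K) x →
      |ρ (x, b) - ρ (x', b)| ≤ ℓB) (κ : ℝ) (z : Site P 0 × F → ℂ) :
    -(B1RG242Torus.α P a P.K * Real.exp (|κ| * ℓB) * nsq z)
      ≤ (conjForm (((msq : ℂ) • (1 : Matrix (Site P 0 × F) (Site P 0 × F) ℂ) + flatLap P F + (B1RG242Torus.α P a P.K : ℂ) • Pf P F)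
          - flatLap P F) κ ρ z).re := by
  have hsplit : ((msq : ℂ) • (1 : Matrix (Site P 0 × F) (Site P 0 × F) ℂ) + flatLap P F + (B1RG242Torus.α P a P.K : ℂ) • Pf P F)
      - flatLap P F = (msq : ℂ) • 1 + (B1RG242Torus.α P a P.K : ℂ) • Pf P F := by abel
  rw [hsplit, conjForm_add, Complex.add_re, conjForm_smul_one, ← Complex.ofReal_mul, Complex.ofReal_re]
  have hP : -((Real.exp (|κ| * ℓB) + Real.exp (|κ| * ℓB)) / 2 * nsq z) ≤ (conjForm (Pf P F) κ ρ z).re :=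
    re_conjForm_ge_neg_schur (Pf P F) κ ρ (cRow_Pf_le ρ hρB κ) (cCol_Pf_le ρ hρB κ) z
  have hPs : (conjForm ((B1RG242Torus.α P a P.K : ℂ) • Pf P F) κ ρ z).re = B1RG242Torus.α P a P.K * (conjForm (Pf P F) κ ρ z).re := by
    rw [conjForm_eq, conjMat_smul, Matrix.smul_mulVec, dotProduct_smul, smul_eq_mul, ← conjForm_eq, Complex.re_ofReal_mul]
  rw [hPs]
  have h1 : 0 ≤ msq * nsq z := mul_nonneg hmsq (nsq_nonneg z)
  nlinarith [mul_le_mul_of_nonneg_left hP hα, nsq_nonneg z]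

end Summit.QuantumFields.BalabanUV.Gaps.D4WalkBlockFormBaseTorus

end
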